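import Literature.NumberTheory.NumberFields.SqrtTwoTowerThreeNormDyadicResidues
import Literature.NumberTheory.IwasawaTheory.ClassGroupLayerThreeOrderFourOfTowerCertificate
import Literature.NumberTheory.IwasawaTheory.ClassGroupPRankLeOfRelationTwoLayer
import Literature.NumberTheory.IwasawaTheory.CyclotomicTwoLayerTwoNonNormUnit
import HarnessLib

/-!
# A unit `η ≢ ±1 (mod 𝔭₁⁵)` at a dyadic prime with `e = f = 1` is NOT a norm from the octic cyclotomic layer `K_3 = K·ℚ(ζ₃₂)⁺`;
# hence `t = 3` (`ε ≡ ±1 (mod 𝔭₁³)`, `ε ≢ ±1 (mod 𝔭₁⁴)`) gives `ε² ∉ N_{K_3/K} K_3ˣ` — THE LEVEL-`32` DYADIC LEMMA — and att-p3 g48's RELATION DOOR AT LAYER `3`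
# in base-field congruence currency

Topic `NumberTheory/IwasawaTheory` (namespace = path).  THEOREM-ONLY file (no definition, no named fact, no instance, no `sorry`), written by the prover seat
`bsd-line-att-p3` g49 (cell `bsd-f1-sign2`, route `AlignedTransportAtTwo`; `--supports` stmt-BirchSwinnertonDyer-22298, closes nothing).  FIELD SIDE of this seat's
`NumberFields/SqrtTwoTowerThreeNormDyadicResidues.lean` (local algebra), built on att-p4 g41's three-step tower coordinates (`NumberFields.exists_coord8_of_tower`,
`IwasawaTheory.exists_generators_three_layers`) and att-p3 g46's localisation package (`NumberFields.exists_prime_uniformizer_localizationAtPrime`).  It discharges the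
unit hypothesis «`ε^{2^j} ∉ N_{K_{j+2}/K} K_{j+2}ˣ`» of att-p3 g48's door `classicalMuVanishes_two_of_relation_of_genusCert_layer` at `j = 1` — the layer `K_3`, habitat
of the cell's hard-core seeds (`N = 1259, 3523, 14891`: `Cl(K_2) = (ℤ/2)³`, relation of order `3 ≤ d ≤ 6` at layer `3`) — from ONE congruence in `𝓞_K`.

* `norm_add_mul_eq_sq_sub_mul_sq` — `[F:E] = 2` Galois, `s² = d ∈ E`, `s ∉ E` ⟹ `N_{F/E}(a + c s) = a² − d c²`.
* ★ `Algebra.norm_tower3_eq` — THE NORM THROUGH THE TOWER `K ⊂ K₁ ⊂ K₂ ⊂ L` (`s₁² = 2`, `s₂² = 2 + s₁`, `s₃² = 2 + s₂`, each step quadratic): for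
  `z = x₀ + x₁s₁ + (x₂ + x₃s₁)s₂ + (x₄ + x₅s₁ + (x₆ + x₇s₁)s₂)s₃`, **`N_{L/K}(z) = V₀² − 2V₁²`** where `U = T^U(x)` (`N_{L/K₂} z = P² − (2+s₂)Q²` on `1, s₁, s₂, s₁s₂`)
  and `V = T^V(U)` (`N_{K₂/K₁}`) are the quadratic templates of the local file (transitivity `Algebra.norm_norm` twice; NO octic form).
* ★ `pow_two_sub_one_not_mem_pow_five` — `ε ≡ ±1 (mod 𝔭³)`, `ε ≢ ±1 (mod 𝔭⁴)`, `2 ∈ 𝔭 ∖ 𝔭²`, `𝓞/𝔭 = 𝔽₂` ⟹ `ε² ∓ 1 ∉ 𝔭⁵` (`ε = ±1 + ϖ³a`, `ϖ ∤ a`).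
* ★★ `unitsIncl_unitsMap_not_mem_map_norm_of_tower3` — `K` a number field, `L/K` Galois containing the three-step tower with `[K₁:K] = [K₂:K₁] = [L:K₂] = 2`; `𝔭₁`
  maximal with `𝓞_K/𝔭₁ = 𝔽₂`, `2 ∈ 𝔭₁ ∖ 𝔭₁²`; `η ∈ 𝓞_Kˣ` with `η − 1 ∉ 𝔭₁⁵`, `η + 1 ∉ 𝔭₁⁵` ⟹ **`η ∉ N_{L/K} Lˣ`** (tree currency
  `unitsIncl K L η ∉ (⊤ : Subgroup Lˣ).map (Herbrand.norm Gal(L/K))`): clear denominators (`t = 2^k v` in `(𝓞_K)_𝔭₁`), the tower norm formula, and the local lemma.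
* ★★ `unitsIncl_unitsMap_not_mem_map_norm_layer_three` — the same for `L = κ.layer 3` of a cyclotomic `ℤ₂`-extension of an odd-degree `K` with `2 ∤ d_K`;
  ★★ `unitsIncl_unitsMap_pow_two_not_mem_map_norm_layer_three` — `t = 3` ⟹ `ε² ∉ N_{K_3/K}`.
* ★★★ `classicalMuVanishes_two_of_relation_of_genusCert_layer_three` — att-p3 g48's RELATION DOOR AT LAYER `3` with the unit hypothesis DISCHARGED: `K` odd degree,
  `2 ∤ d_K`, two dyadic primes, `2 ∤ h_K`, `𝓞_K/𝔭₁ = 𝔽₂`, units `≡ ±1 (mod 𝔭₁³)`, ONE unit `ε ≢ ±1 (mod 𝔭₁⁴)`, the genus certificate `(𝔄, k, π)` for `N_{K_3/K_1}(c)`, and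
  ONE relation of order `d ≤ 6` on `c ∈ Cl(K_3)` ⟹ `rank₂ Cl(K_m) ≤ d ∀ m`, `μ₂(κ) = 0`, `λ₂(κ) ≤ d`.

* ★ `not_four_dvd_card_fixed_layer_three_of_not_mem_pow_four` (§6) — `t = 3` ⟹ **`4 ∤ #Cl(K_3)^{Gal(K_3/K)}`** (Chevalley's bit at layer `3` from congruences).

«`η ∉ N_{K_3/K}K_3ˣ` locally at `𝔭₁`» is the statement that `σ₁(η) ∉ ±1 + 32ℤ₂`, the norm group of `ℚ₂(ζ₃₂)⁺/ℚ₂` on units (local class field theory); only the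
elementary direction is proved and used.  HONEST SCOPE: elementary (quadratic norms, transitivity of the norm, localisation, dyadic residues) plus the tree's doors;
nothing specific to any summit; no certificate for any field is asserted; BSD is not advanced by this file.

References: [NeukirchANT1999] Ch. I §2 (norm as product of conjugates), Ch. I §11 (localisation), Ch. V §1 (norm groups of `ℚ_p(ζ_{pⁿ})`); [Omeara1963] §63B;
[Washington1997] §13.1 (`K_3 = K·ℚ(ζ₃₂)⁺`), §13.3 Prop. 13.22–13.23; [Lang1990] Ch. 13 §4 Lemma 4.1; [Gras2003] IV.4; [Fukuda1994] Thm. 1.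
-/

set_option autoImplicit false

noncomputable section

open scoped NumberField nonZeroDivisors
open NumberField IsDedekindDomain Field Polynomial Finset Module

namespace Literature.NumberTheory.IwasawaTheory

open Literature.NumberTheory.NumberFields Literature.NumberTheory.NumberFields.SqrtTwoTowerNorm
  Literature.NumberTheory.NumberFields.AmbiguousClass Literature.NumberTheory.EllipticCurves
  Literature.NumberTheory.GaloisRepresentations Literature.NumberTheory.GaloisRepresentations.Herbrand
  Literature.NumberTheory.GaloisRepresentations.MinkowskiUnit Literature.NumberTheory.GaloisRepresentations.CyclicNormIndex

/-! ## §1 The norm in a quadratic step `F = E(s)`, `s² = d` -/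

section QuadStep

variable {E F : Type*} [Field E] [Field F] [Algebra E F]

/-- **`N_{F/E}(a + c s) = a² − d c²`** for `F/E` Galois of degree `2`, `s² = d ∈ E`, `s ∉ E` (`Gal(F/E) = {1, σ}` with `σ s = −s`; norm = product of the
conjugates). [cite: NeukirchANT1999, Ch. I §2 Prop. (2.6) (norm as the product of the conjugates)] [cite: Omeara1963, §63B (63:10) (norms from `E(√d)` are `x² − d y²`)] -/
theorem norm_add_mul_eq_sq_sub_mul_sq [FiniteDimensional E F] [IsGalois E F] (h2 : Module.finrank E F = 2) {s : F} {d : E}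
    (hs : s ^ 2 = algebraMap E F d) (hsK : ∀ k : E, algebraMap E F k ≠ s) (a c : E) :
    Algebra.norm E (algebraMap E F a + algebraMap E F c * s) = a ^ 2 - d * c ^ 2 := by
  classical
  have hcard : Fintype.card (F ≃ₐ[E] F) = 2 := by rw [← Nat.card_eq_fintype_card, IsGalois.card_aut_eq_finrank, h2]
  obtain ⟨σ, hσ1⟩ := Fintype.exists_ne_of_one_lt_card (by rw [hcard]; norm_num) (1 : F ≃ₐ[E] F)
  have hσs : σ s = -s := by
    have hprod : (σ s - s) * (σ s + s) = 0 := by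
      have h1 : σ s ^ 2 = algebraMap E F d := by rw [← map_pow, hs, AlgEquiv.commutes]
      linear_combination h1 - hs
    rcases mul_eq_zero.mp hprod with h | h
    · exfalso
      apply hσ1
      ext x
      obtain ⟨a', c', rfl⟩ := exists_eq_add_mul_of_finrank_eq_two h2 hsK x
      rw [map_add, map_mul, AlgEquiv.commutes, AlgEquiv.commutes, sub_eq_zero.mp h, AlgEquiv.one_apply]
    · linear_combination h
  have huniv : ({1, σ} : Finset (F ≃ₐ[E] F)) = Finset.univ :=
    Finset.eq_univ_of_card _ (by rw [Finset.card_pair hσ1.symm, hcard])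
  apply (algebraMap E F).injective
  rw [Algebra.norm_eq_prod_automorphisms, ← huniv, Finset.prod_pair hσ1.symm, AlgEquiv.one_apply, map_add, map_mul,
    AlgEquiv.commutes, AlgEquiv.commutes, hσs, map_sub, map_mul, map_pow, map_pow]
  linear_combination (-(algebraMap E F c) ^ 2) * hs

end QuadStep

/-! ## §2 ★ The norm of the three-step tower through its quadratic steps -/

section Tower3

variable {K K₁ K₂ L : Type*} [Field K] [Field K₁] [Field K₂] [Field L]
  [Algebra K K₁] [Algebra K₁ K₂] [Algebra K K₂] [IsScalarTower K K₁ K₂]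
  [Algebra K₂ L] [Algebra K L] [Algebra K₁ L] [IsScalarTower K K₂ L] [IsScalarTower K₁ K₂ L]

/-- ★ **THE NORM THROUGH THE TOWER.**  `K ⊂ K₁ ⊂ K₂ ⊂ L`, each step Galois quadratic, `s₁² = 2`, `s₂² = 2 + s₁`, `s₃² = 2 + s₂`, `s_i` outside the previous field;
`z = x₀ + x₁s₁ + (x₂ + x₃s₁)s₂ + (x₄ + x₅s₁ + (x₆ + x₇s₁)s₂)s₃`.  With `U = T^U(x)` (the coordinates of `N_{L/K₂} z = P² − (2+s₂)Q²` on `1, s₁, s₂, s₁s₂`) and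
`V = T^V(U)` (`N_{K₂/K₁} U = V₀ + V₁s₁`): **`N_{L/K}(z) = V₀² − 2V₁²`** (`N_{L/K} = N_{K₁/K} ∘ N_{K₂/K₁} ∘ N_{L/K₂}`).
[cite: NeukirchANT1999, Ch. I §2 Prop. (2.6) and Cor. (2.7) (transitivity of the norm)] [cite: Washington1997, §13.1 (`ℚ_3 = ℚ(ζ₃₂)⁺`)] -/
theorem Algebra.norm_tower3_eq [FiniteDimensional K K₁] [IsGalois K K₁] [FiniteDimensional K₁ K₂] [IsGalois K₁ K₂] [FiniteDimensional K₂ L] [IsGalois K₂ L]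
    (h1 : Module.finrank K K₁ = 2) (h2 : Module.finrank K₁ K₂ = 2) (h3 : Module.finrank K₂ L = 2)
    {s₁ : K₁} (hs₁ : s₁ ^ 2 = 2) (hs₁K : ∀ k : K, algebraMap K K₁ k ≠ s₁)
    {s₂ : K₂} (hs₂ : s₂ ^ 2 = algebraMap K₁ K₂ (2 + s₁)) (hs₂K : ∀ x : K₁, algebraMap K₁ K₂ x ≠ s₂)
    {s₃ : L} (hs₃ : s₃ ^ 2 = algebraMap K₂ L (2 + s₂)) (hs₃K : ∀ x : K₂, algebraMap K₂ L x ≠ s₃)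
    (x₀ x₁ x₂ x₃ x₄ x₅ x₆ x₇ : K) {U₀ U₁ U₂ U₃ V₀ V₁ : K}
    (hU₀ : U₀ = -8 * x₇ ^ 2 - 8 * x₆ * x₇ - 4 * x₆ ^ 2 - 8 * x₅ * x₇ - 4 * x₅ * x₆ - 4 * x₅ ^ 2 - 4 * x₄ * x₇ - 4 * x₄ * x₆ - 2 * x₄ ^ 2 + 4 * x₃ ^ 2 + 4 * x₂ * x₃ + 
        2 * x₂ ^ 2 + 2 * x₁ ^ 2 + x₀ ^ 2)
    (hU₁ : U₁ = -4 * x₇ ^ 2 - 8 * x₆ * x₇ - 2 * x₆ ^ 2 - 4 * x₅ * x₇ - 4 * x₅ * x₆ - 4 * x₄ * x₇ - 2 * x₄ * x₆ - 4 * x₄ * x₅ + 2 * x₃ ^ 2 + 4 * x₂ * x₃ + x₂ ^ 2 + 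
        2 * x₀ * x₁)
    (hU₂ : U₂ = -4 * x₇ ^ 2 - 4 * x₆ * x₇ - 2 * x₆ ^ 2 - 8 * x₅ * x₇ - 2 * x₅ ^ 2 - 4 * x₄ * x₆ - x₄ ^ 2 + 4 * x₁ * x₃ + 2 * x₀ * x₂)
    (hU₃ : U₃ = -2 * x₇ ^ 2 - 4 * x₆ * x₇ - x₆ ^ 2 - 4 * x₅ * x₆ - 4 * x₄ * x₇ - 2 * x₄ * x₅ + 2 * x₁ * x₂ + 2 * x₀ * x₃)
    (hV₀ : V₀ = -4 * U₃ ^ 2 - 4 * U₂ * U₃ - 2 * U₂ ^ 2 + 2 * U₁ ^ 2 + U₀ ^ 2) (hV₁ : V₁ = -2 * U₃ ^ 2 - 4 * U₂ * U₃ - U₂ ^ 2 + 2 * U₀ * U₁) :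
    Algebra.norm K (algebraMap K L x₀ + algebraMap K L x₁ * algebraMap K₁ L s₁ + (algebraMap K L x₂ + algebraMap K L x₃ * algebraMap K₁ L s₁) * algebraMap K₂ L s₂ +
      (algebraMap K L x₄ + algebraMap K L x₅ * algebraMap K₁ L s₁ + (algebraMap K L x₆ + algebraMap K L x₇ * algebraMap K₁ L s₁) * algebraMap K₂ L s₂) * s₃) =
      V₀ ^ 2 - 2 * V₁ ^ 2 := by
  -- `z = P + Q s₃` with `P, Q ∈ K₂`
  have hz : algebraMap K L x₀ + algebraMap K L x₁ * algebraMap K₁ L s₁ + (algebraMap K L x₂ + algebraMap K L x₃ * algebraMap K₁ L s₁) * algebraMap K₂ L s₂ +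
      (algebraMap K L x₄ + algebraMap K L x₅ * algebraMap K₁ L s₁ + (algebraMap K L x₆ + algebraMap K L x₇ * algebraMap K₁ L s₁) * algebraMap K₂ L s₂) * s₃ =
      algebraMap K₂ L (algebraMap K K₂ x₀ + algebraMap K K₂ x₁ * algebraMap K₁ K₂ s₁ + (algebraMap K K₂ x₂ + algebraMap K K₂ x₃ * algebraMap K₁ K₂ s₁) * s₂) +
      algebraMap K₂ L (algebraMap K K₂ x₄ + algebraMap K K₂ x₅ * algebraMap K₁ K₂ s₁ + (algebraMap K K₂ x₆ + algebraMap K K₂ x₇ * algebraMap K₁ K₂ s₁) * s₂) * s₃ := by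
    simp only [map_add, map_mul, ← IsScalarTower.algebraMap_apply]
  -- step `L/K₂`
  have hS : (algebraMap K₁ K₂ s₁) ^ 2 = 2 := by rw [← map_pow, hs₁, map_ofNat]
  have hT : s₂ ^ 2 = 2 + algebraMap K₁ K₂ s₁ := by rw [hs₂, map_add, map_ofNat]
  have hPQ : (algebraMap K K₂ x₀ + algebraMap K K₂ x₁ * algebraMap K₁ K₂ s₁ + (algebraMap K K₂ x₂ + algebraMap K K₂ x₃ * algebraMap K₁ K₂ s₁) * s₂) ^ 2 -
      (2 + s₂) * (algebraMap K K₂ x₄ + algebraMap K K₂ x₅ * algebraMap K₁ K₂ s₁ + (algebraMap K K₂ x₆ + algebraMap K K₂ x₇ * algebraMap K₁ K₂ s₁) * s₂) ^ 2 =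
      algebraMap K₁ K₂ (algebraMap K K₁ U₀ + algebraMap K K₁ U₁ * s₁) + algebraMap K₁ K₂ (algebraMap K K₁ U₂ + algebraMap K K₁ U₃ * s₁) * s₂ := by
    rw [hU₀, hU₁, hU₂, hU₃]
    simp only [map_add, map_sub, map_mul, map_pow, map_neg, map_ofNat, ← IsScalarTower.algebraMap_apply]
    linear_combination (-algebraMap K K₂ x₇ ^ 2 * s₂ ^ 3 - 2 * algebraMap K K₂ x₇ ^ 2 * s₂ ^ 2 - 2 * algebraMap K K₂ x₅ * algebraMap K K₂ x₇ * s₂ ^ 2 + 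
        algebraMap K K₂ x₃ ^ 2 * s₂ ^ 2 - 2 * algebraMap K K₂ x₆ * algebraMap K K₂ x₇ * s₂ - 4 * algebraMap K K₂ x₅ * algebraMap K K₂ x₇ * s₂ - 
        algebraMap K K₂ x₅ ^ 2 * s₂ + 2 * algebraMap K K₂ x₁ * algebraMap K K₂ x₃ * s₂ - 4 * algebraMap K K₂ x₆ * algebraMap K K₂ x₇ - 
        2 * algebraMap K K₂ x₅ * algebraMap K K₂ x₆ - 2 * algebraMap K K₂ x₅ ^ 2 - 2 * algebraMap K K₂ x₄ * algebraMap K K₂ x₇ + 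
        2 * algebraMap K K₂ x₂ * algebraMap K K₂ x₃ + algebraMap K K₂ x₁ ^ 2) * hS + (-2 * algebraMap K K₂ x₆ * algebraMap K K₂ x₇ * algebraMap K₁ K₂ s₁ * s₂ - 2 * algebraMap K K₂ x₇ ^ 2 * s₂ - 
        4 * algebraMap K K₂ x₆ * algebraMap K K₂ x₇ * algebraMap K₁ K₂ s₁ - algebraMap K K₂ x₆ ^ 2 * s₂ - 
        2 * algebraMap K K₂ x₅ * algebraMap K K₂ x₆ * algebraMap K₁ K₂ s₁ - 2 * algebraMap K K₂ x₄ * algebraMap K K₂ x₇ * algebraMap K₁ K₂ s₁ + 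
        2 * algebraMap K K₂ x₂ * algebraMap K K₂ x₃ * algebraMap K₁ K₂ s₁ - 4 * algebraMap K K₂ x₇ ^ 2 - 2 * algebraMap K K₂ x₆ ^ 2 - 
        4 * algebraMap K K₂ x₅ * algebraMap K K₂ x₇ - 2 * algebraMap K K₂ x₄ * algebraMap K K₂ x₆ + 2 * algebraMap K K₂ x₃ ^ 2 + 
        algebraMap K K₂ x₂ ^ 2) * hT
  -- step `K₂/K₁`
  have hpq : (algebraMap K K₁ U₀ + algebraMap K K₁ U₁ * s₁) ^ 2 - (2 + s₁) * (algebraMap K K₁ U₂ + algebraMap K K₁ U₃ * s₁) ^ 2 =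
      algebraMap K K₁ V₀ + algebraMap K K₁ V₁ * s₁ := by
    rw [hV₀, hV₁]
    simp only [map_add, map_sub, map_mul, map_pow, map_neg, map_ofNat]
    linear_combination (-algebraMap K K₁ U₃ ^ 2 * s₁ - 2 * algebraMap K K₁ U₃ ^ 2 - 2 * algebraMap K K₁ U₂ * algebraMap K K₁ U₃ + algebraMap K K₁ U₁ ^ 2) * hs₁
  rw [hz, ← Algebra.norm_norm (S := K₂), norm_add_mul_eq_sq_sub_mul_sq h3 hs₃ hs₃K, hPQ, ← Algebra.norm_norm (S := K₁),
    norm_add_mul_eq_sq_sub_mul_sq h2 hs₂ hs₂K, hpq, Algebra.norm_add_mul_eq_sq_sub_two_mul_sq h1 hs₁ hs₁K]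

end Tower3

/-! ## §3 Dyadic residues: `t = 3` ⟹ `ε² ≢ ±1 (mod 𝔭⁵)` -/

section Residue

variable {R : Type*} [CommRing R] [IsDedekindDomain R] (P : Ideal R) [P.IsMaximal]

/-- ★ **`ε ≡ ±1 (mod 𝔭³)` and `ε ≢ ±1 (mod 𝔭⁴)` ⟹ `ε² − 1 ∉ 𝔭⁵` and `ε² + 1 ∉ 𝔭⁵`** at a maximal ideal `𝔭` with `R/𝔭 = 𝔽₂` and `2 ∈ 𝔭 ∖ 𝔭²` (in `R_𝔭`:
`ε = ±1 + ϖ³a` with `ϖ ∤ a`, `2 = ϖw`; `ε² − 1 = ϖ⁴(±wa + ϖ²a²)` has exact valuation `4`, `ε² + 1 = 2 + (ε² − 1)` exact valuation `1`). («`t = 3` ⟹ `σ₁(ε²) ≡ 17 (mod 32)`».)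
[cite: Omeara1963, §63A (dyadic unit residues)] [cite: NeukirchANT1999, Ch. I §11 (localisation at a prime is a DVR)] -/
theorem pow_two_sub_one_not_mem_pow_five (hP0 : P ≠ ⊥) (hres : ∀ r : R, r ∈ P ∨ r - 1 ∈ P) (h2 : (2 : R) ∈ P) (h2' : (2 : R) ∉ P ^ 2)
    {ε : R} (h3 : ε - 1 ∈ P ^ 3 ∨ ε + 1 ∈ P ^ 3) (hε1 : ε - 1 ∉ P ^ 4) (hε2 : ε + 1 ∉ P ^ 4) :
    ε ^ 2 - 1 ∉ P ^ 5 ∧ ε ^ 2 + 1 ∉ P ^ 5 := by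
  classical
  haveI : IsDiscreteValuationRing (Localization.AtPrime P) :=
    IsLocalization.AtPrime.isDiscreteValuationRing_of_dedekind_domain R hP0 _
  set S := Localization.AtPrime P with hS
  obtain ⟨ϖ, hϖ, -, hmem⟩ := exists_prime_uniformizer_localizationAtPrime P hP0 hres
  -- `2 = ϖ w`, `ϖ ∤ w`
  obtain ⟨w, hw⟩ : ϖ ^ 1 ∣ algebraMap R S 2 := (hmem 2 1).mp (by rwa [pow_one])
  rw [pow_one, map_ofNat] at hw
  have hwndvd : ¬ ϖ ∣ w := by
    rintro ⟨w', rfl⟩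
    apply h2'
    rw [hmem, map_ofNat, hw]
    exact ⟨w', by ring⟩
  -- `ε = σ + ϖ³ a` with `ϖ ∤ a`
  have key : ∀ σ : R, (σ = 1 ∨ σ = -1) → ε - σ ∈ P ^ 3 → ε - σ ∉ P ^ 4 → ε ^ 2 - 1 ∉ P ^ 5 ∧ ε ^ 2 + 1 ∉ P ^ 5 := by
    intro σ hσ h3σ h4σ
    obtain ⟨a, ha⟩ := (hmem _ 3).mp h3σ
    have handvd : ¬ ϖ ∣ a := by
      rintro ⟨a', rfl⟩
      exact h4σ ((hmem _ 4).mpr ⟨a', by rw [ha]; ring⟩)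
    rw [map_sub] at ha
    have hσ2 : (algebraMap R S σ) ^ 2 = 1 := by
      rcases hσ with rfl | rfl
      · rw [map_one, one_pow]
      · rw [map_neg, map_one, neg_one_sq]
    have hεS : algebraMap R S ε = algebraMap R S σ + ϖ ^ 3 * a := by linear_combination ha
    -- `ε² − 1 = ϖ⁴ · b` with `ϖ ∤ b`
    have hb : algebraMap R S (ε ^ 2 - 1) = ϖ ^ 4 * (w * algebraMap R S σ * a + ϖ ^ 2 * a ^ 2) := by
      rw [map_sub, map_pow, map_one, hεS]
      linear_combination (1 : S) * hσ2 + (ϖ ^ 3 * algebraMap R S σ * a) * hw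
    have hbndvd : ¬ ϖ ∣ w * algebraMap R S σ * a + ϖ ^ 2 * a ^ 2 := by
      intro hd
      have hd' : ϖ ∣ w * algebraMap R S σ * a := by
        have := hd.sub (dvd_mul_of_dvd_left (dvd_pow_self ϖ two_ne_zero) (a ^ 2))
        simpa using this
      rcases hϖ.dvd_or_dvd hd' with hd'' | hd''
      · rcases hϖ.dvd_or_dvd hd'' with hd''' | hd'''
        · exact hwndvd hd'''
        · -- `ϖ ∣ σ`, `σ = ±1` a unit
          have hσu : IsUnit (algebraMap R S σ) := by
            rcases hσ with rfl | rfl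
            · rw [map_one]; exact isUnit_one
            · rw [map_neg, map_one]; exact isUnit_one.neg
          exact hϖ.not_unit (isUnit_of_dvd_unit hd''' hσu)
      · exact handvd hd''
    refine ⟨fun h5 => ?_, fun h5 => ?_⟩
    · obtain ⟨c, hc⟩ := (hmem _ 5).mp h5
      rw [hb, pow_succ ϖ 4, mul_assoc (ϖ ^ 4) ϖ c] at hc
      have hc' := mul_left_cancel₀ (pow_ne_zero 4 hϖ.ne_zero) hc
      exact hbndvd ⟨c, hc'⟩
    · obtain ⟨c, hc⟩ := (hmem _ 5).mp h5
      have h2eq : algebraMap R S (ε ^ 2 + 1) = ϖ * (w + ϖ ^ 3 * (w * algebraMap R S σ * a + ϖ ^ 2 * a ^ 2)) := by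
        have : algebraMap R S (ε ^ 2 + 1) = 2 + algebraMap R S (ε ^ 2 - 1) := by
          rw [map_add, map_sub, map_pow, map_one]; ring
        rw [this, hb, hw]; ring
      rw [h2eq, pow_succ ϖ 4, show ϖ ^ 4 * ϖ * c = ϖ * (ϖ ^ 4 * c) by ring] at hc
      have hc' := mul_left_cancel₀ hϖ.ne_zero hc
      apply hwndvd
      have : ϖ ∣ w + ϖ ^ 3 * (w * algebraMap R S σ * a + ϖ ^ 2 * a ^ 2) := ⟨ϖ ^ 3 * c, by rw [hc']; ring⟩
      have h' := this.sub (dvd_mul_of_dvd_left (dvd_pow_self ϖ three_ne_zero) (w * algebraMap R S σ * a + ϖ ^ 2 * a ^ 2))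
      simpa using h'
  rcases h3 with h3 | h3
  · exact key 1 (Or.inl rfl) (by simpa using h3) (by simpa using hε1)
  · exact key (-1) (Or.inr rfl) (by simpa using h3) (by simpa using hε2)

end Residue

/-! ## §4 ★★ Number fields: `η ≢ ±1 (mod 𝔭₁⁵)` is not a norm from the three-step tower -/

section NumberField

variable {K K₁ K₂ L : Type*} [Field K] [NumberField K] [Field K₁] [Field K₂] [Field L] [NumberField L]
  [Algebra K K₁] [Algebra K₁ K₂] [Algebra K K₂] [IsScalarTower K K₁ K₂]
  [Algebra K₂ L] [Algebra K L] [Algebra K₁ L] [IsScalarTower K K₂ L] [IsScalarTower K₁ K₂ L]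

set_option maxHeartbeats 1600000 in
/-- ★★ **A unit `η ≢ ±1 (mod 𝔭₁⁵)` is not a norm from the three-step tower.**  `K` a number field, `L/K` Galois containing `K ⊂ K₁ ⊂ K₂ ⊂ L` with
`[K₁:K] = [K₂:K₁] = [L:K₂] = 2` (each Galois), `s₁² = 2`, `s₂² = 2 + s₁`, `s₃² = 2 + s₂`, `s_i` outside the previous field (a model of `K_3 = K·ℚ(ζ₃₂)⁺`); `𝔭₁` a maximal
ideal of `𝓞_K` with `𝓞_K/𝔭₁ = 𝔽₂` and `2 ∈ 𝔭₁ ∖ 𝔭₁²`; `η ∈ 𝓞_Kˣ` with `η − 1 ∉ 𝔭₁⁵`, `η + 1 ∉ 𝔭₁⁵`.  THEN `η ∉ N_{L/K} Lˣ` (tree currency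
`unitsIncl K L η ∉ (⊤ : Subgroup Lˣ).map (Herbrand.norm Gal(L/K))`): a norm `z` with `N(z) = η` has tower coordinates `c/t`, `c ∈ 𝓞_K⁸`; `N(tz) = t⁸η = V₀² − 2V₁²`
(`Algebra.norm_tower3_eq`); in `(𝓞_K)_{𝔭₁}` (`2`-adically digitised, `t = 2^k v`) the local lemma `SqrtTwoTowerNorm.towerNorm_ne_pow_mul_of_not_congr` forbids it.
[cite: NeukirchANT1999, Ch. V §1 (norm group of `ℚ₂(ζ₃₂)`)] [cite: Omeara1963, §63B] [cite: Washington1997, §13.1] -/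
theorem unitsIncl_unitsMap_not_mem_map_norm_of_tower3 [IsGalois K L]
    [FiniteDimensional K K₁] [IsGalois K K₁] [FiniteDimensional K₁ K₂] [IsGalois K₁ K₂] [FiniteDimensional K₂ L] [IsGalois K₂ L]
    (h1 : Module.finrank K K₁ = 2) (h2 : Module.finrank K₁ K₂ = 2) (h3 : Module.finrank K₂ L = 2)
    {s₁ : K₁} (hs₁ : s₁ ^ 2 = 2) (hs₁K : ∀ k : K, algebraMap K K₁ k ≠ s₁)
    {s₂ : K₂} (hs₂ : s₂ ^ 2 = algebraMap K₁ K₂ (2 + s₁)) (hs₂K : ∀ x : K₁, algebraMap K₁ K₂ x ≠ s₂)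
    {s₃ : L} (hs₃ : s₃ ^ 2 = algebraMap K₂ L (2 + s₂)) (hs₃K : ∀ x : K₂, algebraMap K₂ L x ≠ s₃)
    (P : Ideal (𝓞 K)) [P.IsMaximal] (hP0 : P ≠ ⊥) (hres : ∀ r : 𝓞 K, r ∈ P ∨ r - 1 ∈ P)
    (h2P : (2 : 𝓞 K) ∈ P) (h2P' : (2 : 𝓞 K) ∉ P ^ 2) (η : (𝓞 K)ˣ) (hη1 : (η : 𝓞 K) - 1 ∉ P ^ 5) (hη2 : (η : 𝓞 K) + 1 ∉ P ^ 5) :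
    unitsIncl K L (Units.map (algebraMap (𝓞 K) K : 𝓞 K →* K) η) ∉
      (⊤ : Subgroup Lˣ).map (Herbrand.norm (L ≃ₐ[K] L)) := by
  classical
  haveI : FiniteDimensional K L := inferInstance
  rintro ⟨zu, -, hzu⟩
  -- `N_{L/K}(z) = η`
  have hnorm : algebraMap K L (Algebra.norm K (zu : L)) = algebraMap K L (algebraMap (𝓞 K) K η) := by
    rw [Algebra.norm_eq_prod_automorphisms]
    have := congrArg (fun x : Lˣ => (x : L)) hzu
    simp only [Herbrand.norm_apply, Units.coe_prod, val_smul, Units.coe_map, MonoidHom.coe_coe] at this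
    exact this
  have hnormK : Algebra.norm K (zu : L) = algebraMap (𝓞 K) K η := (algebraMap K L).injective hnorm
  -- coordinates and a common denominator
  obtain ⟨x₀, x₁, x₂, x₃, x₄, x₅, x₆, x₇, hz⟩ := exists_coord8_of_tower h1 h2 h3 hs₁K hs₂K hs₃K (zu : L)
  obtain ⟨b, hint⟩ := IsLocalization.exist_integer_multiples_of_finset (nonZeroDivisors (𝓞 K)) ({x₀, x₁, x₂, x₃, x₄, x₅, x₆, x₇} : Finset K)
  set t : 𝓞 K := (b : 𝓞 K) with htdef
  have ht0 : t ≠ 0 := nonZeroDivisors.coe_ne_zero b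
  have hget : ∀ x : K, x ∈ ({x₀, x₁, x₂, x₃, x₄, x₅, x₆, x₇} : Finset K) → ∃ c : 𝓞 K, algebraMap (𝓞 K) K c = algebraMap (𝓞 K) K t * x := by
    intro x hx
    obtain ⟨c, hc⟩ := hint x hx
    exact ⟨c, by rw [hc, Algebra.smul_def]⟩
  obtain ⟨c₀, hc₀⟩ := hget x₀ (by simp)
  obtain ⟨c₁, hc₁⟩ := hget x₁ (by simp)
  obtain ⟨c₂, hc₂⟩ := hget x₂ (by simp)
  obtain ⟨c₃, hc₃⟩ := hget x₃ (by simp)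
  obtain ⟨c₄, hc₄⟩ := hget x₄ (by simp)
  obtain ⟨c₅, hc₅⟩ := hget x₅ (by simp)
  obtain ⟨c₆, hc₆⟩ := hget x₆ (by simp)
  obtain ⟨c₇, hc₇⟩ := hget x₇ (by simp)
  -- `N(t z) = t⁸ η`
  have hfin : Module.finrank K L = 8 := by
    rw [← Module.finrank_mul_finrank K K₂ L, ← Module.finrank_mul_finrank K K₁ K₂, h1, h2, h3]
  have hnorm' : Algebra.norm K (algebraMap K L (algebraMap (𝓞 K) K t) * (zu : L)) = (algebraMap (𝓞 K) K t) ^ 8 * algebraMap (𝓞 K) K η := by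
    rw [map_mul, Algebra.norm_algebraMap, hfin, hnormK]
  have htz : algebraMap K L (algebraMap (𝓞 K) K t) * (zu : L) =
      algebraMap K L (algebraMap (𝓞 K) K c₀) + algebraMap K L (algebraMap (𝓞 K) K c₁) * algebraMap K₁ L s₁ +
        (algebraMap K L (algebraMap (𝓞 K) K c₂) + algebraMap K L (algebraMap (𝓞 K) K c₃) * algebraMap K₁ L s₁) * algebraMap K₂ L s₂ +
      (algebraMap K L (algebraMap (𝓞 K) K c₄) + algebraMap K L (algebraMap (𝓞 K) K c₅) * algebraMap K₁ L s₁ +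
        (algebraMap K L (algebraMap (𝓞 K) K c₆) + algebraMap K L (algebraMap (𝓞 K) K c₇) * algebraMap K₁ L s₁) * algebraMap K₂ L s₂) * s₃ := by
    rw [hz, hc₀, hc₁, hc₂, hc₃, hc₄, hc₅, hc₆, hc₇]
    simp only [map_mul]
    ring
  -- the templates over `𝓞 K`
  obtain ⟨U₀, hU₀⟩ : ∃ y : 𝓞 K, y = -8 * c₇ ^ 2 - 8 * c₆ * c₇ - 4 * c₆ ^ 2 - 8 * c₅ * c₇ - 4 * c₅ * c₆ - 4 * c₅ ^ 2 - 4 * c₄ * c₇ - 4 * c₄ * c₆ - 2 * c₄ ^ 2 + 4 * c₃ ^ 2 + 4 * c₂ * c₃ + 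
        2 * c₂ ^ 2 + 2 * c₁ ^ 2 + c₀ ^ 2 := ⟨_, rfl⟩
  obtain ⟨U₁, hU₁⟩ : ∃ y : 𝓞 K, y = -4 * c₇ ^ 2 - 8 * c₆ * c₇ - 2 * c₆ ^ 2 - 4 * c₅ * c₇ - 4 * c₅ * c₆ - 4 * c₄ * c₇ - 2 * c₄ * c₆ - 4 * c₄ * c₅ + 2 * c₃ ^ 2 + 4 * c₂ * c₃ + c₂ ^ 2 + 
        2 * c₀ * c₁ := ⟨_, rfl⟩
  obtain ⟨U₂, hU₂⟩ : ∃ y : 𝓞 K, y = -4 * c₇ ^ 2 - 4 * c₆ * c₇ - 2 * c₆ ^ 2 - 8 * c₅ * c₇ - 2 * c₅ ^ 2 - 4 * c₄ * c₆ - c₄ ^ 2 + 4 * c₁ * c₃ + 2 * c₀ * c₂ := ⟨_, rfl⟩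
  obtain ⟨U₃, hU₃⟩ : ∃ y : 𝓞 K, y = -2 * c₇ ^ 2 - 4 * c₆ * c₇ - c₆ ^ 2 - 4 * c₅ * c₆ - 4 * c₄ * c₇ - 2 * c₄ * c₅ + 2 * c₁ * c₂ + 2 * c₀ * c₃ := ⟨_, rfl⟩
  obtain ⟨V₀, hV₀⟩ : ∃ y : 𝓞 K, y = -4 * U₃ ^ 2 - 4 * U₂ * U₃ - 2 * U₂ ^ 2 + 2 * U₁ ^ 2 + U₀ ^ 2 := ⟨_, rfl⟩
  obtain ⟨V₁, hV₁⟩ : ∃ y : 𝓞 K, y = -2 * U₃ ^ 2 - 4 * U₂ * U₃ - U₂ ^ 2 + 2 * U₀ * U₁ := ⟨_, rfl⟩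
  have eU₀K := congrArg (algebraMap (𝓞 K) K) hU₀
  have eU₁K := congrArg (algebraMap (𝓞 K) K) hU₁
  have eU₂K := congrArg (algebraMap (𝓞 K) K) hU₂
  have eU₃K := congrArg (algebraMap (𝓞 K) K) hU₃
  have eV₀K := congrArg (algebraMap (𝓞 K) K) hV₀
  have eV₁K := congrArg (algebraMap (𝓞 K) K) hV₁
  simp only [map_add, map_sub, map_mul, map_pow, map_neg, map_ofNat] at eU₀K eU₁K eU₂K eU₃K eV₀K eV₁K
  have hNK := Algebra.norm_tower3_eq h1 h2 h3 hs₁ hs₁K hs₂ hs₂K hs₃ hs₃K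
    (algebraMap (𝓞 K) K c₀) (algebraMap (𝓞 K) K c₁) (algebraMap (𝓞 K) K c₂) (algebraMap (𝓞 K) K c₃)
    (algebraMap (𝓞 K) K c₄) (algebraMap (𝓞 K) K c₅) (algebraMap (𝓞 K) K c₆) (algebraMap (𝓞 K) K c₇) eU₀K eU₁K eU₂K eU₃K eV₀K eV₁K
  rw [htz, hNK] at hnorm'
  -- in `𝓞 K`: `V₀² − 2V₁² = t⁸ η`
  have hR : V₀ ^ 2 - 2 * V₁ ^ 2 = t ^ 8 * (η : 𝓞 K) := by
    apply IsFractionRing.injective (𝓞 K) K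
    simp only [map_sub, map_mul, map_pow, map_ofNat]
    exact hnorm'
  -- the localisation `S = (𝓞 K)_𝔭₁`
  haveI : IsDiscreteValuationRing (Localization.AtPrime P) :=
    IsLocalization.AtPrime.isDiscreteValuationRing_of_dedekind_domain (𝓞 K) hP0 _
  set S := Localization.AtPrime P with hS
  obtain ⟨ϖ, hϖ, hresS, hmem⟩ := exists_prime_uniformizer_localizationAtPrime P hP0 hres
  obtain ⟨u, hu⟩ : ϖ ^ 1 ∣ algebraMap (𝓞 K) S 2 := (hmem 2 1).mp (by rwa [pow_one])
  rw [pow_one, map_ofNat] at hu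
  have hundvd : ¬ ϖ ∣ u := by
    rintro ⟨u', rfl⟩
    apply h2P'
    rw [hmem, map_ofNat, hu]
    exact ⟨u', by ring⟩
  have hmax : IsLocalRing.maximalIdeal S = Ideal.span {ϖ} := (IsDiscreteValuationRing.irreducible_iff_uniformizer ϖ).mp hϖ.irreducible
  have hunit : ∀ r : S, ¬ ϖ ∣ r → IsUnit r := by
    intro r hr
    by_contra hnu
    have hmemr : r ∈ IsLocalRing.maximalIdeal S := (IsLocalRing.mem_maximalIdeal r).mpr (mem_nonunits_iff.mpr hnu)
    rw [hmax, Ideal.mem_span_singleton] at hmemr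
    exact hr hmemr
  obtain ⟨uu, huu⟩ := hunit u hundvd
  have hpar : ∀ r : S, ∃ s, r = 2 * s ∨ r = 1 + 2 * s := by
    intro r
    rcases hresS r with ⟨r', hr'⟩ | ⟨r', hr'⟩
    · refine ⟨↑uu⁻¹ * r', Or.inl ?_⟩
      rw [hu, ← huu, hr']
      rw [mul_assoc, ← mul_assoc (uu : S), Units.mul_inv, one_mul]
    · refine ⟨↑uu⁻¹ * r', Or.inr ?_⟩
      rw [hu, ← huu]
      rw [mul_assoc, ← mul_assoc (uu : S), Units.mul_inv, one_mul, ← hr']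
      ring
  have h2S : ¬ IsUnit (2 : S) := by
    rw [hu]
    exact fun hunit2 => hϖ.not_unit (isUnit_of_mul_isUnit_left hunit2)
  have h20 : (2 : S) ≠ 0 := by
    rw [hu, ← huu]; exact mul_ne_zero hϖ.ne_zero uu.ne_zero
  have hloc : ∀ r : S, IsUnit (1 + 2 * r) := by
    intro r
    apply hunit
    intro hd
    have h1' : ϖ ∣ (1 : S) := by
      have := hd.sub (Dvd.dvd.mul_right (show ϖ ∣ (2 : S) from ⟨u, hu⟩) r)
      simpa using this
    exact hϖ.not_unit (isUnit_of_dvd_one h1')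
  -- the equation in `S`
  have hηS : IsUnit (algebraMap (𝓞 K) S η) := (Units.map (algebraMap (𝓞 K) S : 𝓞 K →* S) η).isUnit
  have hRS := congrArg (algebraMap (𝓞 K) S) hR
  simp only [map_sub, map_mul, map_pow, map_ofNat] at hRS
  -- `t = 2ⁿ · v` with `v` a unit
  have htS0 : algebraMap (𝓞 K) S t ≠ 0 := fun h0 =>
    ht0 (IsLocalization.injective S P.primeCompl_le_nonZeroDivisors (by rw [h0, map_zero]))
  obtain ⟨n, v, hv⟩ := IsDiscreteValuationRing.associated_pow_irreducible htS0 hϖ.irreducible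
  have hϖ2 : ϖ = 2 * ↑uu⁻¹ := by rw [hu, ← huu, mul_assoc, Units.mul_inv, mul_one]
  have htv : algebraMap (𝓞 K) S t = 2 ^ n * ↑(uu ^ n * v)⁻¹ := by
    have : algebraMap (𝓞 K) S t = ϖ ^ n * ↑v⁻¹ := by rw [← hv, mul_assoc, Units.mul_inv, mul_one]
    rw [this, hϖ2, mul_pow, mul_inv, Units.val_mul, ← Units.val_pow_eq_pow_val, inv_pow, mul_assoc]
  -- `η ≢ ±1 (mod 32)` in `S`
  have h32 : (32 : S) = ϖ ^ 5 * u ^ 5 := by rw [show (32 : S) = 2 ^ 5 by norm_num, hu]; ring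
  have hη1S : ∀ q : S, algebraMap (𝓞 K) S η ≠ 1 + 32 * q := by
    intro q hq
    apply hη1
    rw [hmem, map_sub, map_one, hq]
    exact ⟨u ^ 5 * q, by rw [h32]; ring⟩
  have hη2S : ∀ q : S, algebraMap (𝓞 K) S η ≠ -1 + 32 * q := by
    intro q hq
    apply hη2
    rw [hmem, map_add, map_one, hq]
    exact ⟨u ^ 5 * q, by rw [h32]; ring⟩
  -- the templates in `S`
  have eU₀ := congrArg (algebraMap (𝓞 K) S) hU₀
  have eU₁ := congrArg (algebraMap (𝓞 K) S) hU₁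
  have eU₂ := congrArg (algebraMap (𝓞 K) S) hU₂
  have eU₃ := congrArg (algebraMap (𝓞 K) S) hU₃
  have eV₀ := congrArg (algebraMap (𝓞 K) S) hV₀
  have eV₁ := congrArg (algebraMap (𝓞 K) S) hV₁
  simp only [map_add, map_sub, map_mul, map_pow, map_neg, map_ofNat] at eU₀ eU₁ eU₂ eU₃ eV₀ eV₁
  refine towerNorm_ne_pow_mul_of_not_congr h2S h20 hpar hloc hηS (uu ^ n * v)⁻¹.isUnit hη1S hη2S n
    _ _ _ _ _ _ _ _ _ _ _ _ _ _ eU₀ eU₁ eU₂ eU₃ eV₀ eV₁ ?_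
  rw [hRS, htv]
  ring

end NumberField

/-! ## §5 ★★ The cyclotomic layer `K_3` -/

section Layer

variable {K : Type} [Field K] [NumberField K]

set_option maxHeartbeats 1600000 in
set_option synthInstance.maxHeartbeats 400000 in
/-- ★★ **`η ≢ ±1 (mod 𝔭₁⁵)` ⟹ `η ∉ N_{K_3/K} K_3ˣ`** for the third layer `K_3 = K·ℚ(ζ₃₂)⁺` of a cyclotomic `ℤ₂`-extension of a number field `K` of odd degree with
`2 ∤ d_K` (the tower `K ⊂ K_1 ⊂ K_2 ⊂ K_3` with `s₁² = 2`, `s₂² = 2 + s₁`, `s₃² = 2 + s₂` is the tree's `exists_generators_three_layers`).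
[cite: Washington1997, §13.1 (`K_3 = K·ℚ(ζ₃₂)⁺`)] [cite: NeukirchANT1999, Ch. V §1] -/
theorem unitsIncl_unitsMap_not_mem_map_norm_layer_three (hK : ¬ 2 ∣ Module.finrank ℚ K) (hd : ¬ (2 : ℤ) ∣ NumberField.discr K)
    (κ : ZpExtension K 2) (hκ : κ.IsCyclotomic) [NumberField (κ.layer 3)]
    (P : Ideal (𝓞 K)) [P.IsMaximal] (hP0 : P ≠ ⊥) (hres : ∀ r : 𝓞 K, r ∈ P ∨ r - 1 ∈ P)
    (h2 : (2 : 𝓞 K) ∈ P) (h2' : (2 : 𝓞 K) ∉ P ^ 2) (η : (𝓞 K)ˣ) (hη1 : (η : 𝓞 K) - 1 ∉ P ^ 5) (hη2 : (η : 𝓞 K) + 1 ∉ P ^ 5) :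
    unitsIncl K (κ.layer 3) (Units.map (algebraMap (𝓞 K) K : 𝓞 K →* K) η) ∉
      (⊤ : Subgroup (κ.layer 3)ˣ).map (Herbrand.norm ((κ.layer 3) ≃ₐ[K] (κ.layer 3))) := by
  classical
  haveI : Fact (Nat.Prime 2) := ⟨Nat.prime_two⟩
  have h12 : κ.layer 1 ≤ κ.layer 2 := κ.layer_mono one_le_two
  have h23 : κ.layer 2 ≤ κ.layer 3 := κ.layer_mono (by norm_num)
  have h13 : κ.layer 1 ≤ κ.layer 3 := h12.trans h23
  letI alg12 : Algebra (κ.layer 1) (κ.layer 2) := (IntermediateField.inclusion h12).toRingHom.toAlgebra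
  letI alg23 : Algebra (κ.layer 2) (κ.layer 3) := (IntermediateField.inclusion h23).toRingHom.toAlgebra
  letI alg13 : Algebra (κ.layer 1) (κ.layer 3) := (IntermediateField.inclusion h13).toRingHom.toAlgebra
  haveI tow12 : IsScalarTower K (κ.layer 1) (κ.layer 2) :=
    IsScalarTower.of_algebraMap_eq fun x => ((IntermediateField.inclusion h12).commutes x).symm
  haveI tow23 : IsScalarTower K (κ.layer 2) (κ.layer 3) :=
    IsScalarTower.of_algebraMap_eq fun x => ((IntermediateField.inclusion h23).commutes x).symm
  haveI tow13 : IsScalarTower K (κ.layer 1) (κ.layer 3) :=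
    IsScalarTower.of_algebraMap_eq fun x => ((IntermediateField.inclusion h13).commutes x).symm
  haveI tow123 : IsScalarTower (κ.layer 1) (κ.layer 2) (κ.layer 3) :=
    IsScalarTower.of_algebraMap_eq fun x => (IntermediateField.inclusion_inclusion h12 h23 x).symm
  haveI : FiniteDimensional K (κ.layer 1) := κ.finiteDimensional_layer_holds 1
  haveI : FiniteDimensional K (κ.layer 2) := κ.finiteDimensional_layer_holds 2
  haveI : FiniteDimensional K (κ.layer 3) := κ.finiteDimensional_layer_holds 3
  haveI : NumberField (κ.layer 1) := NumberField.of_module_finite K _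
  haveI : NumberField (κ.layer 2) := NumberField.of_module_finite K _
  haveI : IsGalois K (κ.layer 1) := κ.isGalois_layer_holds 1
  haveI : IsGalois K (κ.layer 2) := κ.isGalois_layer_holds 2
  haveI : IsGalois K (κ.layer 3) := κ.isGalois_layer_holds 3
  haveI : IsGalois (κ.layer 1) (κ.layer 2) := IsGalois.tower_top_of_isGalois K _ _
  haveI : IsGalois (κ.layer 2) (κ.layer 3) := IsGalois.tower_top_of_isGalois K _ _
  haveI : FiniteDimensional (κ.layer 1) (κ.layer 2) := Module.Finite.of_restrictScalars_finite K _ _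
  haveI : FiniteDimensional (κ.layer 2) (κ.layer 3) := Module.Finite.of_restrictScalars_finite K _ _
  have hdeg1 : Module.finrank K (κ.layer 1) = 2 := by rw [κ.finrank_layer_holds 1, pow_one]
  have hdeg2 : Module.finrank (κ.layer 1) (κ.layer 2) = 2 := by
    letI : Algebra (κ.layer 1) (κ.layer (1 + 1)) := alg12
    haveI : IsScalarTower K (κ.layer 1) (κ.layer (1 + 1)) := tow12
    exact finrank_layer_one_layer_two κ
  have hdeg3 : Module.finrank (κ.layer 2) (κ.layer 3) = 2 := by
    letI : Algebra (κ.layer 2) (κ.layer (2 + 1)) := alg23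
    haveI : IsScalarTower K (κ.layer 2) (κ.layer (2 + 1)) := tow23
    exact finrank_layer_two_layer_three κ
  obtain ⟨s₁, s₂, s₃, hs₁, hs₂, hs₃, hs₁K, hs₂K, hs₃K⟩ := exists_generators_three_layers hK hd κ hκ
  exact unitsIncl_unitsMap_not_mem_map_norm_of_tower3 hdeg1 hdeg2 hdeg3 hs₁ hs₁K hs₂ hs₂K hs₃ hs₃K P hP0 hres h2 h2' η hη1 hη2

/-- ★★ **`t = 3` ⟹ `ε² ∉ N_{K_3/K} K_3ˣ`.**  `ε ∈ 𝓞_Kˣ` with `ε ≡ ±1 (mod 𝔭₁³)` and `ε ≢ ±1 (mod 𝔭₁⁴)` (`𝔭₁` dyadic with `e = f = 1`) has `ε² ≢ ±1 (mod 𝔭₁⁵)`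
(`pow_two_sub_one_not_mem_pow_five`), so `ε²` is not a norm from `K_3`: the DISPLAYED unit hypothesis `ε^{2^j} ∉ N_{K_{j+2}/K}` of att-p3 g48's layer door at `j = 1`.
[cite: Washington1997, §13.1] [cite: NeukirchANT1999, Ch. V §1] [cite: Omeara1963, §63A–B] -/
theorem unitsIncl_unitsMap_pow_two_not_mem_map_norm_layer_three (hK : ¬ 2 ∣ Module.finrank ℚ K) (hd : ¬ (2 : ℤ) ∣ NumberField.discr K)
    (κ : ZpExtension K 2) (hκ : κ.IsCyclotomic) [NumberField (κ.layer 3)]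
    (P : Ideal (𝓞 K)) [P.IsMaximal] (hP0 : P ≠ ⊥) (hres : ∀ r : 𝓞 K, r ∈ P ∨ r - 1 ∈ P)
    (h2 : (2 : 𝓞 K) ∈ P) (h2' : (2 : 𝓞 K) ∉ P ^ 2) (ε : (𝓞 K)ˣ) (h3 : (ε : 𝓞 K) - 1 ∈ P ^ 3 ∨ (ε : 𝓞 K) + 1 ∈ P ^ 3)
    (hε1 : (ε : 𝓞 K) - 1 ∉ P ^ 4) (hε2 : (ε : 𝓞 K) + 1 ∉ P ^ 4) :
    (unitsIncl K (κ.layer 3) (Units.map (algebraMap (𝓞 K) K : 𝓞 K →* K) ε)) ^ 2 ∉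
      (⊤ : Subgroup (κ.layer 3)ˣ).map (Herbrand.norm ((κ.layer 3) ≃ₐ[K] (κ.layer 3))) := by
  obtain ⟨h5a, h5b⟩ := pow_two_sub_one_not_mem_pow_five P hP0 hres h2 h2' h3 hε1 hε2
  have h := unitsIncl_unitsMap_not_mem_map_norm_layer_three hK hd κ hκ P hP0 hres h2 h2' (ε ^ 2)
    (by rwa [Units.val_pow_eq_pow_val]) (by rwa [Units.val_pow_eq_pow_val])
  rwa [map_pow, map_pow] at h

/-- ★★★ **THE RELATION DOOR AT LAYER `3` FROM BASE-FIELD DATA** (att-p3 g48's `classicalMuVanishes_two_of_relation_of_genusCert_layer` at `j = 1` with its unit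
hypothesis DISCHARGED by the level-`32` lemma).  `K` of odd degree with `2 ∤ d_K` and exactly two primes above `2`, `κ` a cyclotomic `ℤ₂`-extension, `2 ∤ h_K`;
`𝔭₁ ∋ 2` maximal with `𝓞_K/𝔭₁ = 𝔽₂`; every unit `≡ ±1 (mod 𝔭₁³)`; ONE unit `ε` with **`ε − 1 ∉ 𝔭₁⁴` and `ε + 1 ∉ 𝔭₁⁴`** (`t = 3`); a class `c ∈ Cl(K_3)` with the
GENUS CERTIFICATE `(𝔄, k, π)` (`N_{K_3/K_1}(c) = [𝔄]`, `N_{K_1/K}(𝔄)^k = (π)`, `π ≡ ±3 (mod 𝔭₁³)`); `σ` a generator of `Gal(K_3/K)`; ONE RELATION `∏_{i<N} σ^i(c)^{f_i} = 1`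
with `∑ f_i X^i = (X−1)^d·u + 2·g`, `u(1)` odd, `d ≤ 6`.  THEN `rank₂ Cl(K_m) ≤ d` for every `m`, `μ₂(κ) = 0`, `λ₂(κ) ≤ d`.
[cite: Washington1997, §13.3 Prop. 13.22–13.23] [cite: Lang1990, Ch. 13 §4 Lemma 4.1] [cite: Gras2003, IV.4] [cite: Fukuda1994, Thm. 1, p. 264]
[cite: NeukirchANT1999, Ch. V §1] -/
theorem classicalMuVanishes_two_of_relation_of_genusCert_layer_three (hK2 : ¬ 2 ∣ Module.finrank ℚ K) (hd : ¬ (2 : ℤ) ∣ NumberField.discr K)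
    (κ : ZpExtension K 2) (hκ : κ.IsCyclotomic)
    (h2card : {w : HeightOneSpectrum (𝓞 K) | ((2 : ℕ) : 𝓞 K) ∈ w.asIdeal}.ncard = 2)
    (hh : ¬ 2 ∣ classNumber K)
    [NumberField (κ.layer 1)] [NumberField (κ.layer 3)] [Algebra (κ.layer 1) (κ.layer 3)]
    [IsScalarTower K (κ.layer 1) (κ.layer 3)]
    (P : Ideal (𝓞 K)) [P.IsMaximal] (hres : ∀ r : 𝓞 K, r ∈ P ∨ r - 1 ∈ P) (h2P : (2 : 𝓞 K) ∈ P)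
    (hunits : ∀ u : (𝓞 K)ˣ, (u : 𝓞 K) - 1 ∈ P ^ 3 ∨ (u : 𝓞 K) + 1 ∈ P ^ 3)
    (ε : (𝓞 K)ˣ) (hε1 : (ε : 𝓞 K) - 1 ∉ P ^ 4) (hε2 : (ε : 𝓞 K) + 1 ∉ P ^ 4)
    {π : 𝓞 K} (hπ : π - 3 ∈ P ^ 3 ∨ π + 3 ∈ P ^ 3)
    {A : Ideal (𝓞 (κ.layer 1))} (hA0 : A ≠ ⊥) {k : ℕ} (hA : Ideal.relNorm (𝓞 K) A ^ k = Ideal.span {π})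
    (σ : (κ.layer 3) ≃ₐ[K] (κ.layer 3)) (hσ : ∀ τ : (κ.layer 3) ≃ₐ[K] (κ.layer 3), τ ∈ Subgroup.zpowers σ)
    {c : ClassGroup (𝓞 (κ.layer 3))}
    (hcA : classGroupNorm (κ.layer 1) (κ.layer 3) c = ClassGroup.mk0 ⟨A, mem_nonZeroDivisors_of_ne_zero hA0⟩)
    {N d : ℕ} (hd6 : d ≤ 6) {f : ℕ → ℤ} {u g : ℤ[X]} (hu : ¬ (2 : ℤ) ∣ u.eval 1)
    (hF : (∑ i ∈ range N, C (f i) * X ^ i : ℤ[X]) = (X - 1) ^ d * u + C (2 : ℤ) * g)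
    (hrel : ∏ i ∈ range N, (ClassGroup.mulEquiv (intAut (σ ^ i)) c) ^ (f i) = 1) :
    (∀ m, classGroupPRank κ m ≤ d) ∧ ClassicalMuVanishes κ ∧ classicalLambda κ ≤ d := by
  have hP0 : P ≠ ⊥ := fun h0 => by
    rw [h0, Ideal.mem_bot] at h2P
    exact two_ne_zero h2P
  have h2P' : (2 : 𝓞 K) ∉ P ^ 2 := two_not_mem_sq_of_not_dvd_discr hd P h2P
  have hnot := unitsIncl_unitsMap_pow_two_not_mem_map_norm_layer_three hK2 hd κ hκ P hP0 hres h2P h2P' ε (hunits ε) hε1 hε2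
  exact classicalMuVanishes_two_of_relation_of_genusCert_layer hK2 hd κ hκ h2card hh 1 P hres h2P hunits ε
    (by simpa only [pow_one] using hnot) hπ hA0 hA σ hσ hcA (by omega) hu hF hrel

end Layer

/-! ## §6 ★ Chevalley's bit at layer `3` from congruences: `t = 3` ⟹ `4 ∤ #Cl(K_3)^{Gal(K_3/K)}` -/

section ChevalleyThree

variable {K : Type} [Field K] [NumberField K]

/-- ★ **`t = 3` ⟹ `4 ∤ #Cl(K_3)^{Gal(K_3/K)}`.**  `K` of odd degree with `2 ∤ d_K` and exactly two primes above `2`, `κ` a cyclotomic `ℤ₂`-extension, `2 ∤ h_K`;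
`𝔭₁ ∋ 2` maximal with `𝓞_K/𝔭₁ = 𝔽₂`; a unit `ε ≡ ±1 (mod 𝔭₁³)` with `ε ≢ ±1 (mod 𝔭₁⁴)`.  THEN the group of ambiguous classes of `K_3 = K·ℚ(ζ₃₂)⁺` has order
`≢ 0 (mod 4)` (Chevalley: `#fix · 8 · [E_K : E_K ∩ N] = h_K · 64` with `4 ∣ [E_K : E_K ∩ N]` because `ε² ∉ N_{K_3/K} K_3ˣ` — the level-`32` lemma).
[cite: Lang1990, Ch. 13 §4, Lemma 4.1 (PDF pp. 203–204)] [cite: Gras2003, II.6.2.3] [cite: NeukirchANT1999, Ch. V §1] -/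
theorem not_four_dvd_card_fixed_layer_three_of_not_mem_pow_four (hK2 : ¬ 2 ∣ Module.finrank ℚ K) (hd : ¬ (2 : ℤ) ∣ NumberField.discr K)
    (κ : ZpExtension K 2) (hκ : κ.IsCyclotomic)
    (h2card : {w : HeightOneSpectrum (𝓞 K) | ((2 : ℕ) : 𝓞 K) ∈ w.asIdeal}.ncard = 2)
    (hh : ¬ 2 ∣ classNumber K) [NumberField (κ.layer 3)]
    (P : Ideal (𝓞 K)) [P.IsMaximal] (hres : ∀ r : 𝓞 K, r ∈ P ∨ r - 1 ∈ P) (h2P : (2 : 𝓞 K) ∈ P)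
    (ε : (𝓞 K)ˣ) (h3 : (ε : 𝓞 K) - 1 ∈ P ^ 3 ∨ (ε : 𝓞 K) + 1 ∈ P ^ 3)
    (hε1 : (ε : 𝓞 K) - 1 ∉ P ^ 4) (hε2 : (ε : 𝓞 K) + 1 ∉ P ^ 4) :
    ¬ 4 ∣ Nat.card {c : ClassGroup (𝓞 (κ.layer 3)) //
      ∀ τ : (κ.layer 3) ≃ₐ[K] (κ.layer 3), ClassGroup.mulEquiv (intAut τ) c = c} := by
  haveI : Fact (Nat.Prime 2) := ⟨Nat.prime_two⟩
  have hP0 : P ≠ ⊥ := fun h0 => by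
    rw [h0, Ideal.mem_bot] at h2P
    exact two_ne_zero h2P
  have h2P' : (2 : 𝓞 K) ∉ P ^ 2 := two_not_mem_sq_of_not_dvd_discr hd P h2P
  have hodd := forall_odd_ramificationIdx_of_not_dvd_discr hd
  have hκ0 : TotallyRamifiedFrom κ 0 := totallyRamifiedFrom_zero_of_forall_odd_ramificationIdx hK2 κ hκ hodd
  have hnot := unitsIncl_unitsMap_pow_two_not_mem_map_norm_layer_three hK2 hd κ hκ P hP0 hres h2P h2P' ε h3 hε1 hε2
  haveI : NumberField (κ.layer (1 + 2)) := ‹NumberField (κ.layer 3)›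
  exact not_four_dvd_card_fixed_layer_of_pow_not_mem κ hκ0 hh 1
    (by rw [ncard_ramified_layer_eq_ncard_dyadic hK2 κ hκ hodd (by omega : 1 ≤ 1 + 2), h2card])
    (unitsIncl_unitsMap_mem_unitsE_inf_range ε) (by simpa only [pow_one] using hnot)

end ChevalleyThree

end Literature.NumberTheory.IwasawaTheory

end
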